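import Mathlib
import Summits.Ventures.HodgeRepro2.T5EmbeddingPrimeEquiv
import Summits.Ventures.HodgeRepro2.T5SplitsCompletely

/-!
# T5EmbeddingRestriction — restricting embeddings `E → ℚ_p` to a subfield `F`: the place of
`F` below, and «every prime of `F` above `p` splits in `E`» in embedding vocabulary

Tier-5 support (seat p7, cell pub-hodge-repro2), fifth file of the embedding chain, for
route/T5-CHECK-G-p7.md §12.2 row P1.3 (Hsieh's «(ord) Every prime of F above p splits in K»,
kernel-checked in prime vocabulary by row 12's `ord_of_isGalois_of_degree_one`) and row P1.5.
For number fields `F ⊆ E` and an embedding `φ : E →+* ℚ_[p]`: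

* `inducedPrime_restrictEmb`: the prime of `𝓞 F` induced by `φ|_F` is the prime of `𝓞 E` induced
  by `φ`, pulled back to `𝓞 F` («the place of `F` below the place of `E`»);
* `exists_restrictEmb_eq`: when every prime of `E` above `p` has degree one, every embedding
  `F → ℚ_p` EXTENDS to `E` (restriction is surjective);
* `fiberEquivPrimesOver`: the extensions of a fixed `φ₀ : F → ℚ_p` to `E` correspond bijectively
  to the primes of `E` above the prime `𝔭` induced by `φ₀`; hence, for `E/ℚ` Galois,
  `card_fiber_restrictEmb_of_isGalois`: exactly `[E : F]` extensions — (ord) with `[E : F] = 2`.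

Nothing about CM types or Hecke characters is asserted.
-/

namespace Summit.Ventures.HodgeRepro2.T5EmbeddingRestriction

open IsDedekindDomain NumberField T5DegreeOneEmbeddings T5EmbeddingPrimeEquiv

variable {F E : Type*} [Field F] [NumberField F] [Field E] [NumberField E] [Algebra F E]
  {p : ℕ} [hp : Fact p.Prime]

/-- Restriction of an embedding `E → ℚ_p` to the subfield `F`. -/
noncomputable def restrictEmb (φ : E →+* ℚ_[p]) : F →+* ℚ_[p] := φ.comp (algebraMap F E)

omit [NumberField F] [NumberField E] in
/-- `restrictEmb φ x = φ x` for `x ∈ F`. -/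
@[simp]
theorem restrictEmb_apply (φ : E →+* ℚ_[p]) (x : F) : restrictEmb φ x = φ (algebraMap F E x) := rfl

/-- The prime of `𝓞 F` induced by `φ|_F` is the pull-back to `𝓞 F` of the prime of `𝓞 E` induced
by `φ`. -/
theorem inducedPrime_restrictEmb (φ : E →+* ℚ_[p]) :
    (inducedPrime (restrictEmb (F := F) φ)).asIdeal = (inducedPrime φ).asIdeal.under (𝓞 F) := by
  ext x
  rw [mem_inducedPrime_iff, Ideal.mem_under, mem_inducedPrime_iff, restrictEmb_apply,
    ← IsScalarTower.algebraMap_apply (𝓞 F) (𝓞 E) E, IsScalarTower.algebraMap_apply (𝓞 F) F E]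

/-- The prime induced by `φ` lies over the prime induced by `φ|_F`. -/
instance inducedPrime_liesOver_restrictEmb (φ : E →+* ℚ_[p]) :
    (inducedPrime φ).asIdeal.LiesOver (inducedPrime (restrictEmb (F := F) φ)).asIdeal :=
  ⟨inducedPrime_restrictEmb φ⟩

section extension

variable (hsplit : ∀ w : HeightOneSpectrum (𝓞 E), w.asIdeal.LiesOver (Ideal.span {(p : ℤ)}) →
  w.asIdeal.ramificationIdx ℤ * w.asIdeal.inertiaDeg ℤ = 1)

/-- A prime `Q` of `𝓞 E` lying over a height-one prime `𝔭` of `𝓞 F`, as a height-one prime of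
`𝓞 E`. -/
noncomputable def primeAbove (𝔭 : HeightOneSpectrum (𝓞 F)) (Q : Ideal (𝓞 E)) [hQ : Q.IsPrime]
    [hQ𝔭 : Q.LiesOver 𝔭.asIdeal] : HeightOneSpectrum (𝓞 E) where
  asIdeal := Q
  isPrime := hQ
  ne_bot := Ideal.ne_bot_of_liesOver_of_ne_bot 𝔭.ne_bot Q

omit [NumberField F] [NumberField E] in
/-- `(primeAbove 𝔭 Q).asIdeal = Q`. -/
@[simp]
theorem primeAbove_asIdeal (𝔭 : HeightOneSpectrum (𝓞 F)) (Q : Ideal (𝓞 E)) [hQ : Q.IsPrime]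
    [hQ𝔭 : Q.LiesOver 𝔭.asIdeal] : (primeAbove 𝔭 Q).asIdeal = Q := rfl

/-- `primeAbove 𝔭 Q` lies over `p` when `𝔭` does. -/
instance primeAbove_liesOver (𝔭 : HeightOneSpectrum (𝓞 F))
    [h𝔭 : 𝔭.asIdeal.LiesOver (Ideal.span {(p : ℤ)})] (Q : Ideal (𝓞 E)) [Q.IsPrime]
    [hQ𝔭 : Q.LiesOver 𝔭.asIdeal] : (primeAbove 𝔭 Q).asIdeal.LiesOver (Ideal.span {(p : ℤ)}) :=
  Ideal.LiesOver.trans Q 𝔭.asIdeal _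

include hsplit in
/-- The embedding of `E` attached to a prime `Q` above the prime `𝔭` induced by `φ₀` restricts to
`φ₀` on `F`. -/
theorem restrictEmb_embedding_primeAbove (φ₀ : F →+* ℚ_[p]) (Q : Ideal (𝓞 E)) [hQ : Q.IsPrime]
    [hQ𝔭 : Q.LiesOver (inducedPrime φ₀).asIdeal] :
    restrictEmb (embedding (primeAbove (inducedPrime φ₀) Q) p
      (hsplit _ (primeAbove_liesOver _ Q))) = φ₀ := by
  apply inducedPrime_injective
  apply HeightOneSpectrum.ext
  rw [inducedPrime_restrictEmb, inducedPrime_embedding, primeAbove_asIdeal]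
  exact hQ𝔭.over.symm

include hsplit in
/-- **Every embedding `F → ℚ_p` extends to `E`** when every prime of `E` above `p` has degree
one (restriction `Hom(E, ℚ_p) → Hom(F, ℚ_p)` is surjective). -/
theorem exists_restrictEmb_eq (φ₀ : F →+* ℚ_[p]) :
    ∃ φ : E →+* ℚ_[p], restrictEmb φ = φ₀ := by
  obtain ⟨Q, hQmax, hQ⟩ :=
    Ideal.exists_maximal_ideal_liesOver_of_isIntegral (S := 𝓞 E) (inducedPrime φ₀).asIdeal
  haveI : Q.IsPrime := hQmax.isPrime
  haveI := hQ
  exact ⟨_, restrictEmb_embedding_primeAbove hsplit φ₀ Q⟩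

/-- The extensions of `φ₀ : F → ℚ_p` to `E` correspond bijectively to the primes of `𝓞 E` lying
over the prime of `𝓞 F` induced by `φ₀`. -/
noncomputable def fiberEquivPrimesOver (φ₀ : F →+* ℚ_[p]) :
    {φ : E →+* ℚ_[p] // restrictEmb φ = φ₀} ≃ (inducedPrime φ₀).asIdeal.primesOver (𝓞 E) where
  toFun φ := ⟨(inducedPrime φ.1).asIdeal, (inducedPrime φ.1).isPrime, by
    refine ⟨?_⟩
    rw [← inducedPrime_restrictEmb, φ.2]⟩
  invFun Q :=
    haveI : Q.1.IsPrime := Q.2.1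
    haveI : Q.1.LiesOver (inducedPrime φ₀).asIdeal := Q.2.2
    ⟨embedding (primeAbove (inducedPrime φ₀) Q.1) p (hsplit _ (primeAbove_liesOver _ Q.1)),
      restrictEmb_embedding_primeAbove hsplit φ₀ Q.1⟩
  left_inv φ := by
    apply Subtype.ext
    have h := embedding_inducedPrime φ.1
    exact h
  right_inv Q := by
    apply Subtype.ext
    haveI : Q.1.IsPrime := Q.2.1
    haveI : Q.1.LiesOver (inducedPrime φ₀).asIdeal := Q.2.2
    exact congrArg HeightOneSpectrum.asIdeal
      (inducedPrime_embedding (primeAbove (inducedPrime φ₀) Q.1)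
        (hsplit _ (primeAbove_liesOver _ Q.1)))

include hsplit in
/-- The number of extensions of `φ₀` to `E` is the number of primes of `E` above the prime
induced by `φ₀`. -/
theorem card_fiber_restrictEmb (φ₀ : F →+* ℚ_[p]) :
    Nat.card {φ : E →+* ℚ_[p] // restrictEmb φ = φ₀} =
      ((inducedPrime φ₀).asIdeal.primesOver (𝓞 E)).ncard := by
  rw [Nat.card_congr (fiberEquivPrimesOver hsplit φ₀), Nat.card_coe_set_eq]

end extension

/-- **(ord) in embedding vocabulary**: for `E/ℚ` Galois with one degree-one prime above `p`,
every embedding `φ₀ : F → ℚ_p` has exactly `[E : F]` extensions to `E` — the prime of `F` induced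
by `φ₀` splits into `[E : F]` primes of `E` (row 12's `ord_of_isGalois_of_degree_one`). -/
theorem card_fiber_restrictEmb_of_isGalois [IsGalois ℚ E] (w₀ : HeightOneSpectrum (𝓞 E))
    [hw₀ : w₀.asIdeal.LiesOver (Ideal.span {(p : ℤ)})]
    (hdeg₀ : w₀.asIdeal.ramificationIdx ℤ * w₀.asIdeal.inertiaDeg ℤ = 1) (φ₀ : F →+* ℚ_[p]) :
    Nat.card {φ : E →+* ℚ_[p] // restrictEmb φ = φ₀} = Module.finrank F E := by
  rw [card_fiber_restrictEmb (forall_degree_one_of_isGalois E p w₀ hdeg₀) φ₀]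
  have h₀ : ((p : ℤ) : 𝓞 E) ∈ w₀.asIdeal := by
    rw [Int.cast_natCast]; exact T5DegreeOneQuotient.natCast_mem_of_liesOver
  have h₁ : ((p : ℤ) : 𝓞 F) ∈ (inducedPrime φ₀).asIdeal := by
    rw [Int.cast_natCast]; exact natCast_mem_inducedIdeal φ₀
  exact T5SplitsCompletely.ord_of_isGalois_of_degree_one F E (Nat.prime_iff_prime_int.mp hp.out)
    w₀.asIdeal h₀ hdeg₀ (inducedPrime φ₀).asIdeal h₁

end Summit.Ventures.HodgeRepro2.T5EmbeddingRestriction
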